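import Literature.AlgebraicGeometry.HodgeTheory.SubvariationIrreducibleOfFlatSpan
import Literature.AlgebraicGeometry.HodgeTheory.FlatEndomorphismEigenspaceSubvariation
import Literature.AlgebraicGeometry.HodgeTheory.FibrewiseDeckRelations
import Literature.AlgebraicGeometry.HodgeTheory.DirectImageEndomorphism
import Literature.AlgebraicGeometry.HodgeTheory.BettiUniverseAxioms
import Literature.AlgebraicGeometry.HodgeTheory.BettiUniverseKunnethHodgePowersNormalForm
import Literature.AlgebraicGeometry.HodgeTheory.DiagonalSymmetryStability
import Summits.HodgeConjecture.HodgeConjecture.Theorems.Q8SymplecticPowersMonodromyDeckCommutes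
import Summits.HodgeConjecture.HodgeConjecture.Theorems.Q8SymplecticPowersFiniteOrbitInvariantOfIrreducible
import Summits.HodgeConjecture.HodgeConjecture.Theorems.Q8SymplecticPowersDeckIsometry
import HarnessLib

/-!
# Route `Q8SymplecticPowers`, crux K1Q (stmt-HodgeConjecture-24190), stub S4 `stub_transcendentalQuaternionicPartQ`:
# conjuncts (iii) AND (iv) at a member from ONE flat-span certificate for `ker(τ_s^* − i)`

Prover seat `hodge-nonav-20241-p1` (g22); helper `--supports stmt-HodgeConjecture-24190` (it does NOT close a
registered stub). Line «mechanism-v2», skeleton v6 (planner p3 g37): S4's conclusion at a base point `s` is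
`(o) ∧ (o′) ∧ (i) ∧ (ii) ∧ ((iii)) ∧ (iv)` with (iii) «every finite-index `Γ' ≤ Γ_s` acts irreducibly on
`Miv = (ker(A²+1) ∩ N^⊥) ⊗ ℂ ∩ ker(A_ℂ − i)`» and (iv) «`N ≤ ker(A² − 1)`» (`A = τ_s^*`, `N` = the finite-orbit
span, `Γ_s` = the rational monodromy group). The cell's criterion (C44) (memo `ROUTE-P3v28-g37.md` §7), landed
as `Literature.AlgebraicGeometry.HodgeTheory.eq_bot_or_eq_of_stable_of_flatSpan`
(`SubvariationIrreducibleOfFlatSpan.lean`), turns a ONE-MEMBER certificate (FS)_s «the flat span of the line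
`M ∩ F²` near `s` is all of `M`» into irreducibility of a sub-variation `M` under every finite-index subgroup.

THIS FILE applies it to `M := ker(A_ℂ − i)` itself — `Γ`-stable by deck∕monodromy commutation (G1,
`apply_pull_fiberOverEnd_of_mem_ratMonodromyGroup`), and `β_s M` = the `i`-eigenspace of the flat,
type-preserving field `t ↦ τ_t^*` on `H²(X_t(ℂ); ℂ)`, a complex sub-variation (`isSubvariation_eigenspace`) —
and then DERIVES both registered conjuncts:

* (iv) `span_finiteIndexFixed_le_eigenspace_sq_one_of_irreducible` (pure linear algebra, companion file
  `Q8SymplecticPowersFiniteOrbitInvariantOfIrreducible`): `N` is `Γ`- and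
  `A`-stable and pointwise fixed by one finite-index `Γ₀` (`exists_finiteIndex_normal_span_fixed_iff`);
  `P := (N ∩ ker(A²+1)) ⊗ ℂ ∩ M` is `Γ₀`-stable in `M`, so `P ∈ {0, M}`; `P = M` makes a line of `M` stable
  (`dim M ≥ 2` excluded); `P = 0` gives, for `n ∈ N ∩ ker(A²+1)` and `x = 1 ⊗ n`, `A x = −i x` and, by
  complex conjugation, `A x = i x`, so `n = 0`; hence `N ∩ ker(A²+1) = 0` and `N ≤ ker(A² − 1)` (`A⁴ = 1`).
* (iii) with (iv) and the `A`-isometry of `Qf = tr ∘ cup` (`tr_cup_pull_pull_of_pull_pow_eq_one`, needs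
  (o′)_s), `ker(A²+1) ≤ N^⊥`, so `Mv = ker(A²+1)` and `Miv = M`; (iii) for `Miv` is the irreducibility of `M`.

Main theorem `stable_eq_bot_or_eq_and_finiteOrbit_invariant_of_flatSpan`: for a smooth projective family of
surfaces `π : 𝒳 → S` (`𝒳`, `S` quasi-projective, `S` smooth of dimension `d`, `hU`), `τ : 𝒳 → 𝒳` over `S`,
`s ∈ S(ℂ)`, in the VERBATIM `let`-currency of the registered S4 (`Xs, hXs, A, Qf, Γ, N, Mv, Miv`;
`hodge exists_isReal_hodgeModel_holds`): FACT B → `A ^ 4 = 1` → (o′)_s → `2 ≤ finrank M` →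
`finrank (M ⊓ F²) ≤ 1` → (FS)_s for `M` → `((iii)) ∧ (iv)`. So ONE exact certificate at one member
(JetSpan, the cell's T-Q20₄) discharges (iii) and (iv) there; no separate «closure = Sp» computation is needed.

(Appended) `transcendentalQuaternionicPart_at_member_of_flatSpan`: the EXACT six-conjunct conclusion of S4 at the
member `s` — `(o) ∧ (o′) ∧ (i) ∧ (ii) ∧ ((iii)) ∧ (iv)` — from FACT B, `A⁴ = 1`, the counts (o), (o′),
`6 ≤ finrank M`, `finrank (M ⊓ F²) ≤ 1`, and (FS)_s ((i) from (iv) + (o); (ii) from `Miv = M`).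

HONEST FRAMING: a conditional helper; (FS)_s, FACT B (Deligne 1987 Prop. 1.13, print) and the two
Hodge-number inputs are hypotheses; S4 is NOT closed (it quantifies over every `e`, every family of the
model programme and every `s`, and has four more conjuncts); K1Q ∕ HC ∕ HC_AV are NOT proved.
-/

noncomputable section

set_option linter.dupNamespace false

namespace Summit.HodgeConjecture.HodgeConjecture.Theorems.Q8SymplecticPowersTranscendentalIrreducibleOfFlatSpan

open CategoryTheory CategoryTheory.Limits AlgebraicGeometry
open scoped TensorProduct
open Literature.AlgebraicTopology.SingularHomology
open Literature.AlgebraicGeometry.Motives Literature.AlgebraicGeometry.HodgeTheory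
open Literature.AlgebraicGeometry.HodgeTheory.BettiUniverse
open Summit.HodgeConjecture.HodgeConjecture.Theorems.Q8SymplecticPowersTransportRestriction
open Summit.HodgeConjecture.HodgeConjecture.Theorems.Q8SymplecticPowersFiniteOrbitInvariantOfIrreducible

/-! ### The family: `M = ker(A_ℂ − i)` is a `Γ`-stable sub-variation; S4 (iii) ∧ (iv) from (FS)_s -/

section Family

/-- `β ∘ (φ^* ⊗ ℂ) = φ^*_ℂ ∘ β`: the complexified rational pull-back read on `Hᵏ(·(ℂ); ℂ)`.
[cite: VoisinHodgeI2002, §7.1.1] -/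
theorem ofRatClassBaseChange_baseChange_pull {X Y : SchemeOver ℂ} (φ : Y ⟶ X) (k : ℕ)
    (x : ℂ ⊗[ℚ] bettiCohomology X k) :
    ofRatClassBaseChange (ComplexPoints Y) k ((pull φ k).baseChange ℂ x) =
      complexBetti.map φ k (ofRatClassBaseChange (ComplexPoints X) k x) := by
  induction x using TensorProduct.induction_on with
  | zero =>
    rw [map_zero, map_zero]
    exact (map_zero _).symm
  | tmul c v =>
    rw [LinearMap.baseChange_tmul, ofRatClassBaseChange_tmul, ofRatClassBaseChange_tmul, ofRatClass_pull]
    exact (map_smul _ c _).symm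
  | add x y hx hy =>
    rw [map_add, map_add, hx, hy, map_add]
    exact (map_add _ _ _).symm

variable {𝒳 S : SchemeOver ℂ}

/-- **S4 (iii) and (iv) at a member from ONE flat-span certificate.** `π : 𝒳 → S` a smooth projective
family of surfaces, `𝒳`, `S` quasi-projective, `S` smooth of dimension `d`, `R² π_* ℂ` locally trivial
(`hU`), `τ : 𝒳 → 𝒳` over `S`, `s ∈ S(ℂ)`; the `let`s are those of the registered stub S4
`stub_transcendentalQuaternionicPartQ` of crux K1Q (`A = τ_s^*`, `Qf = tr ∘ cup`, `Γ` the rational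
monodromy group, `N` the finite-orbit span, `Mv = ker(A² + 1) ∩ N^⊥`, `Miv = Mv ⊗ ℂ ∩ ker(A_ℂ − i)`),
and `M := ker(A_ℂ − i)`. HYPOTHESES: FACT B (Deligne 1987 Prop. 1.13); `A⁴ = 1`; (o′)_s
`p_g^{τ²=−1}(X_s) > 0`; `2 ≤ dim M`; `dim(M ∩ F²) ≤ 1`; and (FS)_s for `M` — no proper subspace of `M`
contains the lines `M ∩ F²(X_t)` (pulled back to `s` by rational transport) for all members `t` near
`s`. CONCLUSION: S4 (iii) (every finite-index `Γ' ≤ Γ` acts irreducibly on `Miv`) AND S4-v6 (iv)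
(`N ≤ ker(A² − 1)`). Chain: `M` is `Γ`-stable (deck∕monodromy commutation G1) and `β_s M` is the
`i`-eigenspace of the flat type-preserving field `τ_t^*`, a sub-variation (`isSubvariation_eigenspace`);
`eq_bot_or_eq_of_stable_of_flatSpan` ⇒ `M` irreducible under every finite-index `Γ'`;
`span_finiteIndexFixed_le_eigenspace_sq_one_of_irreducible` ⇒ (iv); (iv) + the `A`-isometry of `Qf`
⇒ `ker(A²+1) ≤ N^⊥`, so `Mv = ker(A²+1)` and `Miv = M` ⇒ (iii). HONEST FRAMING: (FS)_s, FACT B and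
the Hodge-number inputs are hypotheses; nothing here proves S4, K1Q or HC.
[cite: Deligne1987, §1.12–1.13 (p. 10–11)] [cite: VoisinHodgeI2002, §9.3.1 Prop. 9.20 and §10.2.1 Thm. 10.3] -/
theorem stable_eq_bot_or_eq_and_finiteOrbit_invariant_of_flatSpan
    (hDelB : deligne1987_monodromy_directSum_irreducible_subvariations)
    (π : 𝒳 ⟶ S) (d : ℕ) (hπ : IsSmoothProjectiveFamily π 2)
    (h𝒳 : IsQuasiProjectiveOver 𝒳) (hS : IsQuasiProjectiveOver S)
    [AlgebraicGeometry.SmoothOfRelativeDimension d S.hom]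
    (hU : IsCohomologicallyLocallyTrivialOn π (Set.univ : Set (ComplexPoints S)))
    (τ : 𝒳 ⟶ 𝒳) (hτπ : τ ≫ π = π) (s : ComplexPoints S) :
    let Xs := fiberOver π s
    let hXs : IsSmoothProjective 2 Xs := hπ.isSmoothProjective s
    let A : bettiCohomology Xs 2 →ₗ[ℚ] bettiCohomology Xs 2 := pull (fiberOverEnd π τ hτπ s) 2
    let Qf : LinearMap.BilinForm ℚ (bettiCohomology Xs 2) := LinearMap.compr₂ (cup Xs 2 2) (tr hXs (2 + 2))
    let Γ := ratMonodromyGroup π 2 hU ⟨s, Set.mem_univ s⟩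
    let N : Submodule ℚ (bettiCohomology Xs 2) := Submodule.span ℚ {x | ∃ Γ' : Subgroup
      (bettiCohomology Xs 2 ≃ₗ[ℚ] bettiCohomology Xs 2), Γ' ≤ Γ ∧ (Γ'.subgroupOf Γ).FiniteIndex ∧
        ∀ γ ∈ Γ', γ x = x}
    let Mv : Submodule ℚ (bettiCohomology Xs 2) := Module.End.eigenspace (A ^ 2) (-1) ⊓ Qf.orthogonal N
    let Miv : Submodule ℂ (TensorProduct ℚ ℂ (bettiCohomology Xs 2)) :=
      Mv.baseChange ℂ ⊓ Module.End.eigenspace (A.baseChange ℂ) Complex.I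
    let M : Submodule ℂ (TensorProduct ℚ ℂ (bettiCohomology Xs 2)) :=
      Module.End.eigenspace (A.baseChange ℂ) Complex.I
    A ^ 4 = 1 →
    0 < Module.finrank ℂ ↥(Module.End.eigenspace ((A ^ 2).baseChange ℂ) (-1) ⊓
      (hodge exists_isReal_hodgeModel_holds hXs 2).piece 2 0) →
    2 ≤ Module.finrank ℂ ↥M →
    Module.finrank ℂ ↥(M ⊓ (hodge exists_isReal_hodgeModel_holds hXs 2).F 2) ≤ 1 →
    (∀ P : Submodule ℂ (TensorProduct ℚ ℂ (bettiCohomology Xs 2)), P < M →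
      ∀ W : Set (Set.univ : Set (ComplexPoints S)), IsOpen W →
        (⟨s, Set.mem_univ s⟩ : (Set.univ : Set (ComplexPoints S))) ∈ W →
        ∃ t ∈ W, ∃ ε : Path (⟨s, Set.mem_univ s⟩ : (Set.univ : Set (ComplexPoints S))) t, (∀ r, ε r ∈ W) ∧
          ∀ (T : bettiCohomology Xs 2 ≃ₗ[ℚ] bettiCohomology (fiberOver π t.1) 2),
            (∀ v, ofRatClass _ 2 (T v) = transportFun π 2 hU ⟦ε⟧ (ofRatClass _ 2 v)) →
            ¬ (M ⊓ ((hodge exists_isReal_hodgeModel_holds (hπ.isSmoothProjective t.1) 2).comapEquiv T).F 2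
                  ≤ P)) →
    (∀ Γ' : Subgroup (bettiCohomology Xs 2 ≃ₗ[ℚ] bettiCohomology Xs 2), Γ' ≤ Γ →
        (Γ'.subgroupOf Γ).FiniteIndex → ∀ F : Submodule ℂ (TensorProduct ℚ ℂ (bettiCohomology Xs 2)),
          F ≤ Miv → (∀ γ ∈ Γ', ∀ x ∈ F, (γ.toLinearMap.baseChange ℂ) x ∈ F) → F = ⊥ ∨ F = Miv) ∧
      N ≤ Module.End.eigenspace (A ^ 2) 1 := by
  intro Xs hXs A Qf Γ N Mv Miv M hA4 ho' h2 ha hFS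
  classical
  haveI hfin : ∀ t : ComplexPoints S, Module.Finite ℚ (bettiCohomology (fiberOver π t) 2) :=
    fun t ↦ finite (hπ.isSmoothProjective t) 2
  -- the real Hodge models of the fibres (`(Am t).hodgeStructure … 2 = hodge … 2` definitionally)
  let Am : ∀ t : ComplexPoints S, HodgeModel 2 (fiberOver π t) := fun t ↦
    realHodgeModel exists_isReal_hodgeModel_holds (hπ.isSmoothProjective t)
  have hAm : ∀ t, (Am t).IsHodgeSymmetric := fun t ↦
    realHodgeModel_isHodgeSymmetric exists_isReal_hodgeModel_holds (hπ.isSmoothProjective t)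
  let e := ofRatClassBaseChangeEquiv hXs 2
  -- G1: `A` commutes with `Γ`
  have hAΓ : ∀ γ ∈ Γ, ∀ x, γ (A x) = A (γ x) := fun γ hγ x ↦
    Q8SymplecticPowersMonodromyDeckCommutes.apply_pull_fiberOverEnd_of_mem_ratMonodromyGroup π 2 hU τ hτπ s hγ x
  -- ### Step 1: `M` is `Γ`-stable and `β_s M` is a sub-variation
  have hM_def : M = Module.End.eigenspace (A.baseChange ℂ) Complex.I := rfl
  have hMstab : ∀ γ ∈ Γ, ∀ x ∈ M, ((γ : _ →ₗ[ℚ] _).baseChange ℂ) x ∈ M := by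
    intro γ hγ x hx
    have hc : (γ : _ →ₗ[ℚ] _) ∘ₗ A = A ∘ₗ (γ : _ →ₗ[ℚ] _) := LinearMap.ext fun y ↦ hAΓ γ hγ y
    have hcomm : ∀ y, ((γ : _ →ₗ[ℚ] _).baseChange ℂ) (A.baseChange ℂ y) =
        A.baseChange ℂ (((γ : _ →ₗ[ℚ] _).baseChange ℂ) y) := fun y ↦ by
      have := congrArg (fun f : bettiCohomology Xs 2 →ₗ[ℚ] bettiCohomology Xs 2 ↦ f.baseChange ℂ y) hc
      simpa only [LinearMap.baseChange_comp, LinearMap.comp_apply] using this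
    rw [hM_def] at hx ⊢
    exact apply_mem_eigenspace_of_comm hcomm hx
  -- the complexified fibrewise deck action
  let τC : ∀ t : (Set.univ : Set (ComplexPoints S)),
      complexBetti (fiberOver π t.1) 2 →ₗ[ℂ] complexBetti (fiberOver π t.1) 2 := fun t ↦
    (complexBetti.map (fiberOverEnd π τ hτπ t.1) 2).hom
  have hτC : ∀ (t : (Set.univ : Set (ComplexPoints S))) (y : complexBetti (fiberOver π t.1) 2),
      τC t y = complexBetti.map (fiberOverEnd π τ hτπ t.1) 2 y := fun t y ↦ rfl
  have hflat : ∀ (t : (Set.univ : Set (ComplexPoints S)))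
      (γ : Path.Homotopic.Quotient (⟨s, Set.mem_univ s⟩ : (Set.univ : Set (ComplexPoints S))) t)
      (x : complexBetti (fiberOver π s) 2),
      transportFun π 2 hU γ (τC ⟨s, Set.mem_univ s⟩ x) = τC t (transportFun π 2 hU γ x) :=
    fun t γ x ↦ transportFun_map_fiberHom π 2 hU τ hτπ (fun t ↦ fiberOverEnd π τ hτπ t)
      (fun t ↦ fiberOverEnd_comp_fiberι π τ hτπ t) γ x
  have htype : ∀ (t : (Set.univ : Set (ComplexPoints S))) (p q : ℕ) (x : complexBetti (fiberOver π t.1) 2),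
      IsOfHodgeType 2 (fiberOver π t.1) 2 p q x → IsOfHodgeType 2 (fiberOver π t.1) 2 p q (τC t x) :=
    fun t p q x hx ↦ IsOfHodgeType.map_endomorphism (hπ.isSmoothProjective t.1) (fiberOverEnd π τ hτπ t.1) hx
  have hmap : M.map e.toLinearMap = Module.End.eigenspace (τC ⟨s, Set.mem_univ s⟩) Complex.I := by
    ext y
    constructor
    · rintro ⟨x, hx, rfl⟩
      rw [SetLike.mem_coe, Module.End.mem_eigenspace_iff] at hx
      rw [Module.End.mem_eigenspace_iff, LinearEquiv.coe_coe, hτC, ofRatClassBaseChangeEquiv_apply,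
        ← ofRatClassBaseChange_baseChange_pull, hx, map_smul]
    · intro hy
      rw [Module.End.mem_eigenspace_iff] at hy
      refine ⟨e.symm y, ?_, e.apply_symm_apply y⟩
      rw [SetLike.mem_coe, Module.End.mem_eigenspace_iff]
      apply e.injective
      rw [map_smul, e.apply_symm_apply, ofRatClassBaseChangeEquiv_apply, ofRatClassBaseChange_baseChange_pull,
        ← ofRatClassBaseChangeEquiv_apply hXs, e.apply_symm_apply]
      exact hy
  have hMv : IsSubvariation π 2 hU 2 ⟨s, Set.mem_univ s⟩ (M.map e.toLinearMap) := by
    rw [hmap]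
    exact isSubvariation_eigenspace (fun t ↦ hπ.isSmoothProjective t.1) τC hflat htype Complex.I
  have hM0 : M ≠ ⊥ := fun h ↦ by
    rw [h, finrank_bot] at h2
    exact absurd h2 (by norm_num)
  -- ### Step 2: `M` is irreducible under every finite-index `Γ'`
  have hirr : ∀ Γ' : Subgroup (bettiCohomology Xs 2 ≃ₗ[ℚ] bettiCohomology Xs 2), Γ' ≤ Γ →
      (Γ'.subgroupOf Γ).FiniteIndex → ∀ F : Submodule ℂ (TensorProduct ℚ ℂ (bettiCohomology Xs 2)),
        F ≤ M → (∀ γ ∈ Γ', ∀ x ∈ F, ((γ : _ →ₗ[ℚ] _).baseChange ℂ) x ∈ F) → F = ⊥ ∨ F = M :=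
    fun Γ' hΓ' hfi F hF hFs ↦
      eq_bot_or_eq_of_stable_of_flatSpan hDelB π 2 2 d hπ hS h𝒳 hU Am hAm ⟨s, Set.mem_univ s⟩ hMv hM0 2
        ha hFS hfi (fun γ hγ x hx ↦ hMstab γ (hΓ' hγ) x hx) F hF hFs
  -- ### Step 3: (iv)
  have hiv : N ≤ Module.End.eigenspace (A ^ 2) 1 :=
    span_finiteIndexFixed_le_eigenspace_sq_one_of_irreducible Γ A hA4 hAΓ h2 hirr
  -- ### Step 4: `Mv = ker(A² + 1)` and `Miv = M`
  have hpg : (hodge exists_isReal_hodgeModel_holds hXs 2).piece 2 0 ≠ ⊥ := by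
    intro h0
    rw [h0, inf_bot_eq, finrank_bot] at ho'
    exact lt_irrefl 0 ho'
  have hAQ : ∀ x y, Qf (A x) (A y) = Qf x y := fun x y ↦
    Q8SymplecticPowersDeckIsometry.tr_cup_pull_pull_of_pull_pow_eq_one hXs (fiberOverEnd π τ hτπ s)
      (by norm_num : 0 < 4) hA4 hpg x y
  have hA2 : ∀ x, (A ^ 2) x = A (A x) := fun x ↦ by rw [pow_two, Module.End.mul_apply]
  have hMv_eq : Mv = Module.End.eigenspace (A ^ 2) (-1) := by
    refine le_antisymm inf_le_left (le_inf le_rfl fun x hx ↦ ?_)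
    rw [LinearMap.BilinForm.mem_orthogonal_iff]
    intro n hn
    have hn1 : (A ^ 2) n = n := by simpa only [one_smul] using Module.End.mem_eigenspace_iff.1 (hiv hn)
    have hx1 : (A ^ 2) x = -x := by simpa only [neg_one_smul] using Module.End.mem_eigenspace_iff.1 hx
    have hQ : Qf n x = Qf ((A ^ 2) n) ((A ^ 2) x) := by rw [hA2, hA2, hAQ, hAQ]
    rw [hn1, hx1, map_neg] at hQ
    -- `Qf n x = - Qf n x`
    change Qf n x = 0
    linarith
  have hMiv_eq : Miv = M := by
    change Mv.baseChange ℂ ⊓ M = M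
    refine inf_eq_right.2 fun x hx ↦ ?_
    rw [hMv_eq, mem_baseChange_eigenspace_iff]
    have hx' := Module.End.mem_eigenspace_iff.1 hx
    rw [LinearMap.baseChange_pow, pow_two, Module.End.mul_apply, hx', map_smul, hx', smul_smul,
      Complex.I_mul_I]
    push_cast
    ring_nf
  -- ### Step 5: assemble
  refine ⟨fun Γ' hΓ' hfi F hF hFs ↦ ?_, hiv⟩
  rw [hMiv_eq] at hF ⊢
  exact hirr Γ' hΓ' hfi F hF hFs

/-- **All six S4 conjuncts at a member from the flat-span certificate and the three Hodge counts.** In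
the verbatim `let`-currency of the registered S4 (`stub_transcendentalQuaternionicPartQ`, v6), at a base
point `s`: FACT B → `A ^ 4 = 1` → (o)_s → (o′)_s → `6 ≤ dim M` → `dim(M ∩ F²) ≤ 1` → (FS)_s for
`M := ker(A_ℂ − i)` → `(o) ∧ (o′) ∧ (i) ∧ (ii) ∧ ((iii)) ∧ (iv)` — the EXACT conclusion of S4 at `s`.
Over `stable_eq_bot_or_eq_and_finiteOrbit_invariant_of_flatSpan` ((iii) ∧ (iv)): (i) `N_ℂ ∩ H^{2,0} = 0`
follows from (iv) `N ≤ ker(A² − 1)` and (o); (ii) `6 ≤ dim Miv` from `Miv = M` ((iv) + the `A`-isometry of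
`Qf`) and `6 ≤ dim M`. So at the certified member the S4₄ closer needs exactly: FACT B, `A⁴ = 1`, the counts
(o), (o′), `dim M ≥ 6`, `dim(M ∩ F²) ≤ 1`, and (FS)_s. HONEST FRAMING: conditional helper; S4 ∕ K1Q ∕ HC NOT
proved. [cite: Deligne1987, §1.12–1.13 (p. 10–11)] [cite: VoisinHodgeI2002, §9.3.1 Prop. 9.20 and §10.2.1 Thm. 10.3] -/
theorem transcendentalQuaternionicPart_at_member_of_flatSpan
    (hDelB : deligne1987_monodromy_directSum_irreducible_subvariations)
    (π : 𝒳 ⟶ S) (d : ℕ) (hπ : IsSmoothProjectiveFamily π 2)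
    (h𝒳 : IsQuasiProjectiveOver 𝒳) (hS : IsQuasiProjectiveOver S)
    [AlgebraicGeometry.SmoothOfRelativeDimension d S.hom]
    (hU : IsCohomologicallyLocallyTrivialOn π (Set.univ : Set (ComplexPoints S)))
    (τ : 𝒳 ⟶ 𝒳) (hτπ : τ ≫ π = π) (s : ComplexPoints S) :
    let Xs := fiberOver π s
    let hXs : IsSmoothProjective 2 Xs := hπ.isSmoothProjective s
    let A : bettiCohomology Xs 2 →ₗ[ℚ] bettiCohomology Xs 2 := pull (fiberOverEnd π τ hτπ s) 2
    let Qf : LinearMap.BilinForm ℚ (bettiCohomology Xs 2) := LinearMap.compr₂ (cup Xs 2 2) (tr hXs (2 + 2))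
    let Γ := ratMonodromyGroup π 2 hU ⟨s, Set.mem_univ s⟩
    let N : Submodule ℚ (bettiCohomology Xs 2) := Submodule.span ℚ {x | ∃ Γ' : Subgroup
      (bettiCohomology Xs 2 ≃ₗ[ℚ] bettiCohomology Xs 2), Γ' ≤ Γ ∧ (Γ'.subgroupOf Γ).FiniteIndex ∧
        ∀ γ ∈ Γ', γ x = x}
    let Mv : Submodule ℚ (bettiCohomology Xs 2) := Module.End.eigenspace (A ^ 2) (-1) ⊓ Qf.orthogonal N
    let Miv : Submodule ℂ (TensorProduct ℚ ℂ (bettiCohomology Xs 2)) :=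
      Mv.baseChange ℂ ⊓ Module.End.eigenspace (A.baseChange ℂ) Complex.I
    let M : Submodule ℂ (TensorProduct ℚ ℂ (bettiCohomology Xs 2)) :=
      Module.End.eigenspace (A.baseChange ℂ) Complex.I
    A ^ 4 = 1 →
    Module.finrank ℂ ↥(Module.End.eigenspace ((A ^ 2).baseChange ℂ) 1 ⊓
      (hodge exists_isReal_hodgeModel_holds hXs 2).piece 2 0) = 0 →
    0 < Module.finrank ℂ ↥(Module.End.eigenspace ((A ^ 2).baseChange ℂ) (-1) ⊓
      (hodge exists_isReal_hodgeModel_holds hXs 2).piece 2 0) →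
    6 ≤ Module.finrank ℂ ↥M →
    Module.finrank ℂ ↥(M ⊓ (hodge exists_isReal_hodgeModel_holds hXs 2).F 2) ≤ 1 →
    (∀ P : Submodule ℂ (TensorProduct ℚ ℂ (bettiCohomology Xs 2)), P < M →
      ∀ W : Set (Set.univ : Set (ComplexPoints S)), IsOpen W →
        (⟨s, Set.mem_univ s⟩ : (Set.univ : Set (ComplexPoints S))) ∈ W →
        ∃ t ∈ W, ∃ ε : Path (⟨s, Set.mem_univ s⟩ : (Set.univ : Set (ComplexPoints S))) t, (∀ r, ε r ∈ W) ∧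
          ∀ (T : bettiCohomology Xs 2 ≃ₗ[ℚ] bettiCohomology (fiberOver π t.1) 2),
            (∀ v, ofRatClass _ 2 (T v) = transportFun π 2 hU ⟦ε⟧ (ofRatClass _ 2 v)) →
            ¬ (M ⊓ ((hodge exists_isReal_hodgeModel_holds (hπ.isSmoothProjective t.1) 2).comapEquiv T).F 2
                  ≤ P)) →
    Module.finrank ℂ ↥(Module.End.eigenspace ((A ^ 2).baseChange ℂ) 1 ⊓
        (hodge exists_isReal_hodgeModel_holds hXs 2).piece 2 0) = 0 ∧
      0 < Module.finrank ℂ ↥(Module.End.eigenspace ((A ^ 2).baseChange ℂ) (-1) ⊓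
        (hodge exists_isReal_hodgeModel_holds hXs 2).piece 2 0) ∧
      (N.baseChange ℂ ⊓ (hodge exists_isReal_hodgeModel_holds hXs 2).piece 2 0 = ⊥) ∧
      6 ≤ Module.finrank ℂ ↥Miv ∧
      (∀ Γ' : Subgroup (bettiCohomology Xs 2 ≃ₗ[ℚ] bettiCohomology Xs 2), Γ' ≤ Γ →
        (Γ'.subgroupOf Γ).FiniteIndex → ∀ F : Submodule ℂ (TensorProduct ℚ ℂ (bettiCohomology Xs 2)),
          F ≤ Miv → (∀ γ ∈ Γ', ∀ x ∈ F, (γ.toLinearMap.baseChange ℂ) x ∈ F) → F = ⊥ ∨ F = Miv) ∧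
      N ≤ Module.End.eigenspace (A ^ 2) 1 := by
  intro Xs hXs A Qf Γ N Mv Miv M hA4 ho ho' h6 ha hFS
  classical
  haveI hfin : ∀ t : ComplexPoints S, Module.Finite ℚ (bettiCohomology (fiberOver π t) 2) :=
    fun t ↦ finite (hπ.isSmoothProjective t) 2
  have h2 : 2 ≤ Module.finrank ℂ ↥M := le_trans (by norm_num) h6
  obtain ⟨hiii, hiv⟩ := stable_eq_bot_or_eq_and_finiteOrbit_invariant_of_flatSpan hDelB π d hπ h𝒳 hS hU τ hτπ
    s hA4 ho' h2 ha hFS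
  -- (i): `N_ℂ ∩ H^{2,0} ≤ ker(A_ℂ² − 1) ∩ H^{2,0} = 0`
  have hi : N.baseChange ℂ ⊓ (hodge exists_isReal_hodgeModel_holds hXs 2).piece 2 0 = ⊥ := by
    have hle : N.baseChange ℂ ⊓ (hodge exists_isReal_hodgeModel_holds hXs 2).piece 2 0 ≤
        Module.End.eigenspace ((A ^ 2).baseChange ℂ) 1 ⊓ (hodge exists_isReal_hodgeModel_holds hXs 2).piece 2 0 := by
      refine inf_le_inf_right _ fun x hx ↦ ?_
      have hx' := Submodule.baseChange_mono ℂ hiv hx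
      rw [mem_baseChange_eigenspace_iff] at hx'
      rw [Module.End.mem_eigenspace_iff, hx', Rat.cast_one]
    have h0 : Module.End.eigenspace ((A ^ 2).baseChange ℂ) 1 ⊓
        (hodge exists_isReal_hodgeModel_holds hXs 2).piece 2 0 = ⊥ := Submodule.finrank_eq_zero.1 ho
    exact le_bot_iff.1 (h0 ▸ hle)
  -- `Miv = M`: (iv) + the `A`-isometry of `Qf` give `ker(A² + 1) ≤ N^⊥`
  have hpg : (hodge exists_isReal_hodgeModel_holds hXs 2).piece 2 0 ≠ ⊥ := by
    intro h0
    rw [h0, inf_bot_eq, finrank_bot] at ho'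
    exact lt_irrefl 0 ho'
  have hAQ : ∀ x y, Qf (A x) (A y) = Qf x y := fun x y ↦
    Q8SymplecticPowersDeckIsometry.tr_cup_pull_pull_of_pull_pow_eq_one hXs (fiberOverEnd π τ hτπ s)
      (by norm_num : 0 < 4) hA4 hpg x y
  have hA2 : ∀ x, (A ^ 2) x = A (A x) := fun x ↦ by rw [pow_two, Module.End.mul_apply]
  have hMv_eq : Mv = Module.End.eigenspace (A ^ 2) (-1) := by
    refine le_antisymm inf_le_left (le_inf le_rfl fun x hx ↦ ?_)
    rw [LinearMap.BilinForm.mem_orthogonal_iff]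
    intro n hn
    have hn1 : (A ^ 2) n = n := by simpa only [one_smul] using Module.End.mem_eigenspace_iff.1 (hiv hn)
    have hx1 : (A ^ 2) x = -x := by simpa only [neg_one_smul] using Module.End.mem_eigenspace_iff.1 hx
    have hQ : Qf n x = Qf ((A ^ 2) n) ((A ^ 2) x) := by rw [hA2, hA2, hAQ, hAQ]
    rw [hn1, hx1, map_neg] at hQ
    change Qf n x = 0
    linarith
  have hMiv_eq : Miv = M := by
    change Mv.baseChange ℂ ⊓ M = M
    refine inf_eq_right.2 fun x hx ↦ ?_
    rw [hMv_eq, mem_baseChange_eigenspace_iff]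
    have hx' := Module.End.mem_eigenspace_iff.1 hx
    rw [LinearMap.baseChange_pow, pow_two, Module.End.mul_apply, hx', map_smul, hx', smul_smul,
      Complex.I_mul_I]
    push_cast
    ring_nf
  have hii : 6 ≤ Module.finrank ℂ ↥Miv := by rw [hMiv_eq]; exact h6
  exact ⟨ho, ho', hi, hii, hiii, hiv⟩

end Family

end Summit.HodgeConjecture.HodgeConjecture.Theorems.Q8SymplecticPowersTranscendentalIrreducibleOfFlatSpan

end
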